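import Literature.GroupTheory.ArithmeticGroups.SL2PrimePowCentralExtensionLayer
import Literature.NumberTheory.Automorphic.UnboundedDenominatorsInvariantHom
import Literature.NumberTheory.EllipticCurves.ModularCurveGammaIndex
import Mathlib.GroupTheory.QuotientGroup.Basic
import HarnessLib

/-!
# The `p`-primary part of the Schur multiplier of `SL₂(ℤ/p^e)` vanishes for `p ≥ 5` (Beyl)

**Theorem** (`eq_one_of_mem_ker_of_mem_commutator`). Let `p ≥ 5` be prime, `e ≥ 0`, and let `π : E → SL₂(ℤ/p^e)`
be a surjective homomorphism whose kernel is central and of exponent `p`.  Then `ker π ∩ [E, E] = 1`.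

Equivalently: `H₂(SL₂(ℤ/p^e), ℤ)` has no `p`-torsion — the `p`-primary part of F. R. Beyl's computation
`M(SL₂(ℤ/m)) = 0` for `4 ∤ m` [Beyl1986] (Math. Z. 191 (1986) 23–42), and the finite-level content of
`H₂(SL₂(ℤ_p), ℤ) = 0` [CalegariDimitrovTang2025, Lemma 4.5.11].  It is exactly what the invariant form of
[CalegariDimitrovTang2025, Corollary 4.5.3] needs at the primes `ℓ = p` with `p² ∣ N` (the "hard residue" of
the crux memo `cdt_thm1-hcor-structure-g40.md`): the local condition for the factor `SL₂(ℤ/p^e)` of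
`SL₂(ℤ/N)` and `p`-torsion targets.

## Proof (elementary; no cohomology, no Lazard theory, no computer algebra)

Induction on `e` (`ker_inf_commutator_eq_bot_aux`, modulus form so that `e = 1` specialises to `ℤ/p`).
* `e = 0`: `E` is abelian.  * `e = 1` (`base`): transfer to the preimage of the unipotent subgroup
  `Γ₁(p) mod p ≅ ℤ/p`, which is central-by-cyclic hence abelian, of index `(p+1)(p-1)` prime to `p`
  (tree: `pow_index_mem_commutator_of_mem_center`, `index_gamma1_eq_card`, `card_unimodular_prime_pow`).
* `e ≥ 2` (`step`): with `t, l ∈ E` over `T̄, L̄`, the elements `e₀ = t^{p^{e-1}}`, `f₀ = l^{p^{e-1}}`,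
  `h₁ = t f₀ t⁻¹ f₀⁻¹ e₀` generate a subgroup `W` which, by the DESCENT RELATIONS of
  `SL2PrimePowCentralExtensionLayer` (the preimage of the top layer `1 + p^{e-1}𝔰𝔩₂` is abelian; the torus
  `diag(2,2⁻¹)` and `S̄ = T̄⁻¹L̄T̄⁻¹` kill the two cocycle constants), is NORMAL in `E` (`closure_normal`), meets
  `ker π` trivially (`eq_one_of_mem_closure_of_map_eq_one`, rank `3` of the layer) and satisfies
  `π⁻¹(layer) = W · ker π`.  Hence `E/W → SL₂(ℤ/p^{e-1})` is again a surjective central exponent-`p`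
  extension, and the induction hypothesis sends a kernel commutator into `W ∩ ker π = 1`.

The cases `p = 2, 3` are genuinely different (`M(SL₂(ℤ/2^e)) = ℤ/2` for `e ≥ 2`; `SL₂(ℤ/9) → SL₂(𝔽₃)`
splits) and are NOT treated here.
-/

open scoped MatrixGroups
open Matrix Matrix.SpecialLinearGroup

namespace Literature.GroupTheory.ArithmeticGroups

namespace SL2SchurMultiplier

variable {p e : ℕ} {E : Type*} [Group E] {π : E →* SL(2, ZMod (p ^ e))}

section W

variable {e₀ f₀ h₁ : E}

/-- Elements of `W = ⟨e₀, h₁, f₀⟩` for pairwise commuting generators of order dividing `p > 0` are the monomials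
`e₀^a h₁^b f₀^c`. [cite: Rotman1995, Theorem 7.47] -/
theorem exists_pow_of_mem_closure (hp : 0 < p) (heh : Commute e₀ h₁) (hef : Commute e₀ f₀) (hfh : Commute f₀ h₁)
    (pe : e₀ ^ p = 1) (ph : h₁ ^ p = 1) (pf : f₀ ^ p = 1) {x : E}
    (hx : x ∈ Subgroup.closure ({e₀, h₁, f₀} : Set E)) :
    ∃ a b c : ℕ, x = e₀ ^ a * h₁ ^ b * f₀ ^ c := by
  refine Subgroup.closure_induction (p := fun x _ ↦ ∃ a b c : ℕ, x = e₀ ^ a * h₁ ^ b * f₀ ^ c) ?_ ?_ ?_ ?_ hx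
  · intro x hx
    simp only [Set.mem_insert_iff, Set.mem_singleton_iff] at hx
    rcases hx with rfl | rfl | rfl
    · exact ⟨1, 0, 0, by simp⟩
    · exact ⟨0, 1, 0, by simp⟩
    · exact ⟨0, 0, 1, by simp⟩
  · exact ⟨0, 0, 0, by simp⟩
  · rintro x y _ _ ⟨a, b, c, rfl⟩ ⟨a', b', c', rfl⟩
    refine ⟨a + a', b + b', c + c', ?_⟩
    have h1 : Commute (h₁ ^ b * f₀ ^ c) (e₀ ^ a') :=
      ((heh.symm.pow_left b).mul_left (hef.symm.pow_left c)).pow_right a'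
    have h2 : Commute (f₀ ^ c) (h₁ ^ b') := (hfh.pow_left c).pow_right b'
    calc e₀ ^ a * h₁ ^ b * f₀ ^ c * (e₀ ^ a' * h₁ ^ b' * f₀ ^ c')
        = e₀ ^ a * ((h₁ ^ b * f₀ ^ c) * e₀ ^ a') * h₁ ^ b' * f₀ ^ c' := by group
      _ = e₀ ^ a * (e₀ ^ a' * (h₁ ^ b * f₀ ^ c)) * h₁ ^ b' * f₀ ^ c' := by rw [h1.eq]
      _ = e₀ ^ a * e₀ ^ a' * h₁ ^ b * (f₀ ^ c * h₁ ^ b') * f₀ ^ c' := by group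
      _ = e₀ ^ a * e₀ ^ a' * h₁ ^ b * (h₁ ^ b' * f₀ ^ c) * f₀ ^ c' := by rw [h2.eq]
      _ = e₀ ^ (a + a') * h₁ ^ (b + b') * f₀ ^ (c + c') := by rw [pow_add, pow_add, pow_add]; group
  · rintro x _ ⟨a, b, c, rfl⟩
    refine ⟨a * (p - 1), b * (p - 1), c * (p - 1), ?_⟩
    have hinv : ∀ (y : E) (n : ℕ), y ^ p = 1 → (y ^ n)⁻¹ = y ^ (n * (p - 1)) := by
      intro y n hy
      rw [eq_comm, ← mul_eq_one_iff_eq_inv, ← pow_add, ← Nat.mul_succ, Nat.succ_eq_add_one,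
        Nat.sub_add_cancel hp, mul_comm, pow_mul, hy, one_pow]
    have h1 : Commute (e₀ ^ a) (h₁ ^ b * f₀ ^ c) := ((heh.pow_right b).mul_right (hef.pow_right c)).pow_left a
    have h2 : Commute (h₁ ^ b) (f₀ ^ c) := (hfh.symm.pow_right c).pow_left b
    rw [_root_.mul_inv_rev, _root_.mul_inv_rev, hinv _ _ pe, hinv _ _ ph, hinv _ _ pf]
    have h1' : Commute (e₀ ^ (a * (p-1))) (h₁ ^ (b * (p-1)) * f₀ ^ (c * (p-1))) :=
      ((heh.pow_right _).mul_right (hef.pow_right _)).pow_left _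
    have h2' : Commute (h₁ ^ (b * (p-1))) (f₀ ^ (c * (p-1))) := (hfh.symm.pow_right _).pow_left _
    calc f₀ ^ (c * (p - 1)) * (h₁ ^ (b * (p - 1)) * e₀ ^ (a * (p - 1)))
        = (f₀ ^ (c * (p - 1)) * h₁ ^ (b * (p - 1))) * e₀ ^ (a * (p - 1)) := by group
      _ = (h₁ ^ (b * (p - 1)) * f₀ ^ (c * (p - 1))) * e₀ ^ (a * (p - 1)) := by rw [h2'.eq]
      _ = e₀ ^ (a * (p - 1)) * (h₁ ^ (b * (p - 1)) * f₀ ^ (c * (p - 1))) := by rw [h1'.eq]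
      _ = e₀ ^ (a * (p - 1)) * h₁ ^ (b * (p - 1)) * f₀ ^ (c * (p - 1)) := by group

/-- **`W ∩ ker π = 1`**: a monomial `e₀^a h₁^b f₀^c` in the kernel of `π` has `p ∣ a, b, c` (rank `3` of the top
layer, `SL2TopLayer.dvd_of_pow_mul_pow_mul_pow_eq_one`), hence is trivial. [cite: Beyl1986, Theorem
(M(SL(2,ℤ/m)) = 0 for 4 ∤ m), p-primary part] -/
theorem eq_one_of_mem_closure_of_map_eq_one [Fact p.Prime] (he : 2 ≤ e)
    (heh : Commute e₀ h₁) (hef : Commute e₀ f₀) (hfh : Commute f₀ h₁)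
    (pe : e₀ ^ p = 1) (ph : h₁ ^ p = 1) (pf : f₀ ^ p = 1)
    (hE : ((π e₀ : SL(2, ZMod (p ^ e))) : Matrix (Fin 2) (Fin 2) (ZMod (p ^ e))) =
      !![1, (p : ZMod (p ^ e)) ^ (e - 1); 0, 1])
    (hF : ((π f₀ : SL(2, ZMod (p ^ e))) : Matrix (Fin 2) (Fin 2) (ZMod (p ^ e))) =
      !![1, 0; (p : ZMod (p ^ e)) ^ (e - 1), 1])
    (hH : ((π h₁ : SL(2, ZMod (p ^ e))) : Matrix (Fin 2) (Fin 2) (ZMod (p ^ e))) =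
      !![1 + (p : ZMod (p ^ e)) ^ (e - 1), 0; 0, 1 - (p : ZMod (p ^ e)) ^ (e - 1)])
    {x : E} (hx : x ∈ Subgroup.closure ({e₀, h₁, f₀} : Set E)) (hπx : π x = 1) : x = 1 := by
  have hp : p.Prime := Fact.out
  obtain ⟨a, b, c, rfl⟩ := exists_pow_of_mem_closure hp.pos heh hef hfh pe ph pf hx
  rw [map_mul, map_mul, map_pow, map_pow, map_pow] at hπx
  -- reorder to ē^a h̄^b f̄^c form expected by the layer lemma (it is stated as Eb^b * Hb^a * Fb^c)
  obtain ⟨hb, ha, hc⟩ := SL2TopLayer.dvd_of_pow_mul_pow_mul_pow_eq_one p e he (π e₀) (π f₀) (π h₁) hE hF hH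
    (a := b) (b := a) (c := c) hπx
  obtain ⟨a', rfl⟩ := ha
  obtain ⟨b', rfl⟩ := hb
  obtain ⟨c', rfl⟩ := hc
  rw [pow_mul, pow_mul, pow_mul, pe, ph, pf, one_pow, one_pow, one_pow, one_mul, one_mul]

end W

section normal

variable {e₀ f₀ h₁ : E}

/-- Conjugation by `g` preserves `W = ⟨e₀, h₁, f₀⟩` as soon as it maps the three generators into `W`. [cite:
Rotman1995, Theorem 7.47] -/
theorem conj_mem_closure_of_gens {g : E}
    (h1 : g * e₀ * g⁻¹ ∈ Subgroup.closure ({e₀, h₁, f₀} : Set E))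
    (h2 : g * h₁ * g⁻¹ ∈ Subgroup.closure ({e₀, h₁, f₀} : Set E))
    (h3 : g * f₀ * g⁻¹ ∈ Subgroup.closure ({e₀, h₁, f₀} : Set E))
    {w : E} (hw : w ∈ Subgroup.closure ({e₀, h₁, f₀} : Set E)) :
    g * w * g⁻¹ ∈ Subgroup.closure ({e₀, h₁, f₀} : Set E) := by
  have : (Subgroup.closure ({e₀, h₁, f₀} : Set E)).map (MulAut.conj g).toMonoidHom ≤
      Subgroup.closure ({e₀, h₁, f₀} : Set E) := by
    rw [MonoidHom.map_closure, Subgroup.closure_le]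
    rintro _ ⟨x, hx, rfl⟩
    simp only [Set.mem_insert_iff, Set.mem_singleton_iff] at hx
    rcases hx with rfl | rfl | rfl
    · simpa using h1
    · simpa using h2
    · simpa using h3
  exact this ⟨w, hw, by simp⟩

/-- The generators lie in `W = ⟨e₀, h₁, f₀⟩`. [cite: Rotman1995, Theorem 7.47] -/
theorem gens_mem_closure :
    e₀ ∈ Subgroup.closure ({e₀, h₁, f₀} : Set E) ∧ h₁ ∈ Subgroup.closure ({e₀, h₁, f₀} : Set E) ∧
      f₀ ∈ Subgroup.closure ({e₀, h₁, f₀} : Set E) :=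
  ⟨Subgroup.subset_closure (by simp), Subgroup.subset_closure (by simp), Subgroup.subset_closure (by simp)⟩

end normal

section step

variable (hcen : ∀ z : E, π z = 1 → ∀ g : E, g * z = z * g) (hexp : ∀ z : E, π z = 1 → z ^ p = 1)
variable {t l e₀ f₀ h₁ : E} (he₀ : e₀ = t ^ p ^ (e - 1)) (hf₀ : f₀ = l ^ p ^ (e - 1))
  (hh₁ : h₁ = t * f₀ * t⁻¹ * f₀⁻¹ * e₀)
  (ht : ((π t : SL(2, ZMod (p ^ e))) : Matrix (Fin 2) (Fin 2) (ZMod (p ^ e))) = !![1, 1; 0, 1])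
  (hl : ((π l : SL(2, ZMod (p ^ e))) : Matrix (Fin 2) (Fin 2) (ZMod (p ^ e))) = !![1, 0; 1, 1])

include hcen hexp he₀ hf₀ hh₁ ht hl in

/-- **`W = ⟨e₀, h₁, f₀⟩` is normal in `E`** (surjective central exponent-`p` extension of `SL₂(ℤ/p^e)`, `p ≥ 5`,
`e ≥ 2`): by the descent relations `t^{±1}`, `l^{±1}` and the kernel normalise `W`, and `E = ⟨t, l⟩ · ker π`
because `SL₂(ℤ/p^e) = ⟨T̄, L̄⟩`. [cite: Beyl1986, Theorem (M(SL(2,ℤ/m)) = 0 for 4 ∤ m), p-primary part] -/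
theorem closure_normal [Fact p.Prime] (hp5 : 5 ≤ p) (he : 2 ≤ e) (hsurj : Function.Surjective π) :
    (Subgroup.closure ({e₀, h₁, f₀} : Set E)).Normal := by
  have hp : p.Prime := Fact.out
  have hp2 : p ≠ 2 := by omega
  -- torus lift
  obtain ⟨D, b, hDT, hDL, hb⟩ := SL2TopLayer.exists_torus p e hp2 (π t) (π l) ht hl
  obtain ⟨d, hd⟩ := hsurj D
  have hdt : π (d * t * d⁻¹) = π (t ^ 4) := by rw [map_mul, map_mul, map_inv, hd, hDT, map_pow]
  have hdl : π (d * l * d⁻¹) = π (l ^ b) := by rw [map_mul, map_mul, map_inv, hd, hDL, map_pow]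
  obtain ⟨⟨pe, ph, pf⟩, rth, rle, rlh, ⟨rth', rtf'⟩, ⟨rlh', rle'⟩⟩ :=
    SL2CentralExtension.descent_relations hcen hexp he₀ hf₀ hh₁ ht hl hp5 he hdt hdl hb
  have rtf : t * f₀ * t⁻¹ = h₁ * e₀⁻¹ * f₀ := by rw [hh₁]; group
  have rte : t * e₀ * t⁻¹ = e₀ := by rw [he₀]; group
  have rte' : t⁻¹ * e₀ * t = e₀ := by rw [he₀]; group
  have rlf : l * f₀ * l⁻¹ = f₀ := by rw [hf₀]; group
  have rlf' : l⁻¹ * f₀ * l = f₀ := by rw [hf₀]; group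
  set W := Subgroup.closure ({e₀, h₁, f₀} : Set E) with hW
  obtain ⟨meW, mhW, mfW⟩ := (gens_mem_closure : e₀ ∈ W ∧ h₁ ∈ W ∧ f₀ ∈ W)
  -- conjugation by t, t⁻¹, l, l⁻¹ and kernel elements preserves W
  have ct : ∀ w ∈ W, t * w * t⁻¹ ∈ W := fun w hw ↦ conj_mem_closure_of_gens
    (by rw [rte]; exact meW)
    (by rw [rth]; exact W.mul_mem (W.mul_mem mhW (W.inv_mem meW)) (W.inv_mem meW))
    (by rw [rtf]; exact W.mul_mem (W.mul_mem mhW (W.inv_mem meW)) mfW) hw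
  have ct' : ∀ w ∈ W, t⁻¹ * w * t⁻¹⁻¹ ∈ W := fun w hw ↦ conj_mem_closure_of_gens (g := t⁻¹)
    (by rw [inv_inv, rte']; exact meW)
    (by rw [inv_inv, rth']; exact W.mul_mem (W.mul_mem mhW meW) meW)
    (by rw [inv_inv, rtf']; exact W.mul_mem (W.mul_mem mfW (W.inv_mem mhW)) (W.inv_mem meW)) hw
  have cl : ∀ w ∈ W, l * w * l⁻¹ ∈ W := fun w hw ↦ conj_mem_closure_of_gens
    (by rw [rle]; exact W.mul_mem (W.mul_mem meW (W.inv_mem mhW)) (W.inv_mem mfW))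
    (by rw [rlh]; exact W.mul_mem (W.mul_mem mhW mfW) mfW)
    (by rw [rlf]; exact mfW) hw
  have cl' : ∀ w ∈ W, l⁻¹ * w * l⁻¹⁻¹ ∈ W := fun w hw ↦ conj_mem_closure_of_gens (g := l⁻¹)
    (by rw [inv_inv, rle']; exact W.mul_mem (W.mul_mem meW mhW) (W.inv_mem mfW))
    (by rw [inv_inv, rlh']; exact W.mul_mem (W.mul_mem mhW (W.inv_mem mfW)) (W.inv_mem mfW))
    (by rw [inv_inv, rlf']; exact mfW) hw
  -- normalizer contains t, l and the kernel
  have ntl : ∀ g : E, (∀ w ∈ W, g * w * g⁻¹ ∈ W) → (∀ w ∈ W, g⁻¹ * w * g⁻¹⁻¹ ∈ W) → g ∈ Subgroup.normalizer (W : Set E) := by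
    intro g hg hg'
    rw [Subgroup.mem_normalizer_iff]
    intro w
    refine ⟨hg w, fun hw ↦ ?_⟩
    have := hg' _ hw
    rwa [inv_inv, ← mul_assoc, ← mul_assoc, inv_mul_cancel, one_mul, mul_assoc, inv_mul_cancel,
      mul_one] at this
  have hzn : ∀ z : E, π z = 1 → z ∈ Subgroup.normalizer (W : Set E) := by
    intro z hz
    rw [Subgroup.mem_normalizer_iff]
    intro w
    rw [← hcen z hz w, mul_assoc, mul_inv_cancel, mul_one]
  have htn : t ∈ Subgroup.normalizer (W : Set E) := ntl t ct ct'
  have hln : l ∈ Subgroup.normalizer (W : Set E) := ntl l cl cl'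
  -- hence everything
  haveI : NeZero (p ^ e) := ⟨pow_ne_zero _ hp.ne_zero⟩
  have htop : Subgroup.normalizer (W : Set E) = ⊤ := by
    rw [eq_top_iff]
    intro g _
    have hg : π g ∈ Subgroup.map π (Subgroup.closure ({t, l} : Set E)) := by
      rw [MonoidHom.map_closure, Set.image_pair, SL2TopLayer.closure_T_L_eq_top (p ^ e) (π t) (π l) ht hl]
      trivial
    obtain ⟨g', hg', hgg'⟩ := hg
    obtain ⟨z, hz, rfl⟩ := SL2CentralExtension.exists_eq_mul_of_map_eq hgg'.symm
    refine (Subgroup.normalizer (W : Set E)).mul_mem ?_ (hzn z hz)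
    exact (Subgroup.closure_le (K := Subgroup.normalizer (W : Set E))).mpr
      (by intro x hx; simp only [Set.mem_insert_iff, Set.mem_singleton_iff] at hx
          rcases hx with rfl | rfl; exacts [htn, hln]) hg'
  exact Subgroup.normalizer_eq_top_iff.mp htop

end step

section induction

universe u

/-- **Inductive step of the descent.** If every central exponent-`p` extension of `SL₂(ℤ/p^{e-1})` has `ker ∩
[·,·] = 1`, then so does every central exponent-`p` extension `E` of `SL₂(ℤ/p^e)` (`p ≥ 5`, `e ≥ 2`): `E/W` is a
central exponent-`p` extension of `SL₂(ℤ/p^{e-1})` (the kernel of the induced map is `(W · ker π)/W`), and `W ∩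
ker π = 1`. [cite: Beyl1986, Theorem (M(SL(2,ℤ/m)) = 0 for 4 ∤ m), p-primary part] -/
theorem step (p : ℕ) [Fact p.Prime] (hp5 : 5 ≤ p) (e : ℕ) (he : 2 ≤ e) {E : Type u} [Group E]
    (π : E →* SL(2, ZMod (p ^ e))) (hsurj : Function.Surjective π)
    (hcen : ∀ z : E, π z = 1 → ∀ g : E, g * z = z * g) (hexp : ∀ z : E, π z = 1 → z ^ p = 1)
    (IH : ∀ (E' : Type u) [Group E'] (π' : E' →* SL(2, ZMod (p ^ (e - 1)))), Function.Surjective π' →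
      (∀ z : E', π' z = 1 → ∀ g : E', g * z = z * g) → (∀ z : E', π' z = 1 → z ^ p = 1) →
      ∀ z : E', π' z = 1 → z ∈ commutator E' → z = 1) :
    ∀ z : E, π z = 1 → z ∈ commutator E → z = 1 := by
  have hp : p.Prime := Fact.out
  have hp2 : p ≠ 2 := by omega
  haveI : NeZero (p ^ e) := ⟨pow_ne_zero _ hp.ne_zero⟩
  haveI : NeZero (p ^ (e - 1)) := ⟨pow_ne_zero _ hp.ne_zero⟩
  obtain ⟨t, ht'⟩ := hsurj ⟨!![1, 1; 0, 1], by simp [Matrix.det_fin_two_of]⟩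
  obtain ⟨l, hl'⟩ := hsurj ⟨!![1, 0; 1, 1], by simp [Matrix.det_fin_two_of]⟩
  have ht : ((π t : SL(2, ZMod (p ^ e))) : Matrix (Fin 2) (Fin 2) (ZMod (p ^ e))) = !![1, 1; 0, 1] := by
    rw [ht']
  have hl : ((π l : SL(2, ZMod (p ^ e))) : Matrix (Fin 2) (Fin 2) (ZMod (p ^ e))) = !![1, 0; 1, 1] := by
    rw [hl']
  set e₀ : E := t ^ p ^ (e - 1) with he₀
  set f₀ : E := l ^ p ^ (e - 1) with hf₀
  set h₁ : E := t * f₀ * t⁻¹ * f₀⁻¹ * e₀ with hh₁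
  set W : Subgroup E := Subgroup.closure ({e₀, h₁, f₀} : Set E) with hW
  haveI hWn : W.Normal := closure_normal hcen hexp he₀ hf₀ hh₁ ht hl hp5 he hsurj
  have hE := SL2CentralExtension.coe_map_e₀' he₀ ht
  have hF := SL2CentralExtension.coe_map_f₀' hf₀ hl
  have hH := SL2CentralExtension.coe_map_h₁' he₀ hf₀ hh₁ ht hl he
  have heh := SL2CentralExtension.commute_e₀_h₁ hcen he₀ hf₀ hh₁ ht hl he
  have hfh := SL2CentralExtension.commute_f₀_h₁ hcen he₀ hf₀ hh₁ ht hl he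
  have hef := SL2CentralExtension.commute_e₀_f₀ hcen hexp he₀ hf₀ hh₁ ht hl he hp2
  -- orders of the generators (from the descent relations)
  obtain ⟨D, b, hDT, hDL, hb⟩ := SL2TopLayer.exists_torus p e hp2 (π t) (π l) ht hl
  obtain ⟨d, hd⟩ := hsurj D
  have hdt : π (d * t * d⁻¹) = π (t ^ 4) := by rw [map_mul, map_mul, map_inv, hd, hDT, map_pow]
  have hdl : π (d * l * d⁻¹) = π (l ^ b) := by rw [map_mul, map_mul, map_inv, hd, hDL, map_pow]
  obtain ⟨⟨pe, ph, pf⟩, -⟩ :=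
    SL2CentralExtension.descent_relations hcen hexp he₀ hf₀ hh₁ ht hl hp5 he hdt hdl hb
  -- the reduction and the quotient map
  set r := Matrix.SpecialLinearGroup.map (n := Fin 2)
    (ZMod.castHom (pow_dvd_pow p (Nat.sub_le e 1)) (ZMod (p ^ (e - 1)))) with hr
  have hWker : W ≤ (r.comp π).ker := by
    rw [hW, Subgroup.closure_le]
    intro x hx
    simp only [Set.mem_insert_iff, Set.mem_singleton_iff] at hx
    rw [SetLike.mem_coe, MonoidHom.mem_ker, MonoidHom.comp_apply]
    rcases hx with rfl | rfl | rfl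
    · exact SL2CentralExtension.layer_e₀ he₀ ht
    · exact SL2CentralExtension.layer_h₁ he₀ hf₀ hh₁ ht hl he
    · exact SL2CentralExtension.layer_f₀ hf₀ hl
  let π' : E ⧸ W →* SL(2, ZMod (p ^ (e - 1))) := QuotientGroup.lift W (r.comp π) hWker
  have hπ' : ∀ x : E, π' (QuotientGroup.mk x) = r (π x) := fun x ↦ rfl
  have hsurj' : Function.Surjective π' := by
    intro y
    obtain ⟨Y, hY⟩ := SL2TopLayer.map_castHom_surjective (p ^ e) (pow_dvd_pow p (Nat.sub_le e 1)) y
    obtain ⟨x, hx⟩ := hsurj Y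
    exact ⟨QuotientGroup.mk x, by rw [hπ', hx]; exact hY⟩
  -- kernel elements of π' come from W · ker π
  have hker' : ∀ x : E, π' (QuotientGroup.mk x) = 1 → ∃ z : E, π z = 1 ∧ (QuotientGroup.mk x : E ⧸ W) =
      QuotientGroup.mk z := by
    intro x hx
    rw [hπ'] at hx
    obtain ⟨a, b', c, z, hz, hxz⟩ := SL2CentralExtension.exists_decomp he₀ hf₀ hh₁ ht hl he hx
    refine ⟨z, hz, ?_⟩
    rw [hxz, QuotientGroup.mk_mul]
    have hw : e₀ ^ b' * h₁ ^ a * f₀ ^ c ∈ W := by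
      obtain ⟨meW, mhW, mfW⟩ := (gens_mem_closure : e₀ ∈ W ∧ h₁ ∈ W ∧ f₀ ∈ W)
      exact W.mul_mem (W.mul_mem (W.pow_mem meW _) (W.pow_mem mhW _)) (W.pow_mem mfW _)
    rw [(QuotientGroup.eq_one_iff _).mpr hw, one_mul]
  have hcen' : ∀ q : E ⧸ W, π' q = 1 → ∀ g : E ⧸ W, g * q = q * g := by
    intro q hq g
    induction q using QuotientGroup.induction_on with
    | H x =>
      induction g using QuotientGroup.induction_on with
      | H y =>
        obtain ⟨z, hz, hxz⟩ := hker' x hq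
        rw [hxz, ← QuotientGroup.mk_mul, ← QuotientGroup.mk_mul, hcen z hz y]
  have hexp' : ∀ q : E ⧸ W, π' q = 1 → q ^ p = 1 := by
    intro q hq
    induction q using QuotientGroup.induction_on with
    | H x =>
      obtain ⟨z, hz, hxz⟩ := hker' x hq
      rw [hxz, ← QuotientGroup.mk_pow, hexp z hz, QuotientGroup.mk_one]
  intro z hz hzc
  have h1 : π' (QuotientGroup.mk z) = 1 := by rw [hπ', hz, map_one]
  have h2 : (QuotientGroup.mk z : E ⧸ W) ∈ commutator (E ⧸ W) := by
    have := Subgroup.mem_map_of_mem (QuotientGroup.mk' W) hzc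
    rw [commutator_def, Subgroup.map_commutator] at this
    rw [commutator_def]
    exact Subgroup.commutator_mono le_top le_top this
  have h3 := IH (E ⧸ W) π' hsurj' hcen' hexp' _ h1 h2
  have h4 : z ∈ W := (QuotientGroup.eq_one_iff z).mp h3
  exact eq_one_of_mem_closure_of_map_eq_one he heh hef hfh pe ph pf hE hF hH h4 hz


/-- **Base case `e = 1`.** A central extension of `SL₂(𝔽_p)` by a group of exponent `p` has `ker ∩ [E,E] = 1`:
transfer (tree: `pow_index_mem_commutator_of_mem_center`) to the preimage of the unipotent subgroup `Γ₁(p) mod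
p`, which is abelian (central-by-cyclic) of index `(p+1)(p-1)` prime to `p`. [cite: Beyl1986, Theorem
(M(SL(2,ℤ/m)) = 0 for 4 ∤ m), p-primary part] -/
theorem base (p : ℕ) [Fact p.Prime] {E : Type u} [Group E] (π : E →* SL(2, ZMod p))
    (hsurj : Function.Surjective π) (hcen : ∀ z : E, π z = 1 → ∀ g : E, g * z = z * g)
    (hexp : ∀ z : E, π z = 1 → z ^ p = 1) : ∀ z : E, π z = 1 → z ∈ commutator E → z = 1 := by
  have hp : p.Prime := Fact.out
  haveI : NeZero p := ⟨hp.ne_zero⟩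
  set red := Matrix.SpecialLinearGroup.map (n := Fin 2) (Int.castRingHom (ZMod p)) with hred
  set U : Subgroup SL(2, ZMod p) := (CongruenceSubgroup.Gamma1 p).map red with hU
  set H : Subgroup E := U.comap π with hH
  -- index
  have hredsurj : Function.Surjective red :=
    Literature.NumberTheory.EllipticCurves.ModularForms.specialLinearGroup_map_surjective p
  have hidx : H.index = (p + 1) * (p - 1) := by
    rw [hH, Subgroup.index_comap_of_surjective _ hsurj, hU, Subgroup.index_map_eq _ hredsurj]
    · have h := Literature.NumberTheory.EllipticCurves.ModularForms.card_unimodular_prime_pow hp Nat.one_pos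
      rw [pow_one] at h
      rw [Literature.NumberTheory.EllipticCurves.ModularForms.index_gamma1_eq_card, h]
      simp
    · intro g hg
      rw [MonoidHom.mem_ker] at hg
      exact Literature.NumberTheory.EllipticCurves.ModularForms.Gamma_le_Gamma1 p
        (CongruenceSubgroup.Gamma_mem'.mpr hg)
  haveI : H.FiniteIndex := ⟨by rw [hidx]; exact Nat.mul_ne_zero (by omega) (by have := hp.two_le; omega)⟩
  -- a lift of T̄
  obtain ⟨t, ht⟩ := hsurj (red ModularGroup.T)
  -- elements of H are t^k z
  have hHel : ∀ x ∈ H, ∃ (k : ℕ) (z : E), π z = 1 ∧ x = t ^ k * z := by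
    intro x hx
    rw [hH, Subgroup.mem_comap, hU, Subgroup.mem_map] at hx
    obtain ⟨γ, hγ, hγx⟩ := hx
    have hγ' := (CongruenceSubgroup.Gamma1_mem p γ).mp hγ
    obtain ⟨h00, h11, h10⟩ := hγ'
    set k : ℕ := ((γ 0 1 : ℤ) : ZMod p).val with hk
    have hπx : π x = π (t ^ k) := by
      rw [map_pow, ht, ← hγx]
      ext i j
      rw [SL2TopLayer.tBar_pow _ (SL2TopLayer.coe_map_T p) k, hk, ZMod.natCast_zmod_val]
      fin_cases i <;> fin_cases j <;> simp [hred, h00, h11, h10]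
    exact ⟨k, (t ^ k)⁻¹ * x, by rw [map_mul, map_inv, hπx, inv_mul_cancel], by group⟩
  have hHcomm : ∀ x ∈ H, ∀ y ∈ H, x * y = y * x := by
    intro x hx y hy
    obtain ⟨k, z, hz, rfl⟩ := hHel x hx
    obtain ⟨k', z', hz', rfl⟩ := hHel y hy
    have c1 : Commute (t ^ k) (t ^ k') := (Commute.refl t).pow_pow k k'
    have c2 : Commute (t ^ k) z' := hcen z' hz' (t ^ k)
    have c3 : Commute z (t ^ k') := (hcen z hz (t ^ k') : Commute (t ^ k') z).symm
    have c4 : Commute z z' := hcen z' hz' z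
    exact ((c1.mul_right c2).mul_left (c3.mul_right c4)).eq
  have hHbot : commutator H = ⊥ := by
    rw [commutator_def, Subgroup.commutator_eq_bot_iff_le_centralizer]
    rintro ⟨x, hx⟩ - 
    rw [Subgroup.mem_centralizer_iff]
    rintro ⟨y, hy⟩ -
    exact Subtype.ext (hHcomm y hy x hx)
  intro z hz hzcomm
  have hzH : z ∈ H := by
    rw [hH, Subgroup.mem_comap, hz]; exact U.one_mem
  have hzc : z ∈ Subgroup.center E := by
    rw [Subgroup.mem_center_iff]; exact fun g ↦ hcen z hz g
  have h1 := Literature.NumberTheory.Automorphic.UnboundedDenominators.pow_index_mem_commutator_of_mem_center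
    H hzH hzc hzcomm
  rw [hHbot, Subgroup.mem_bot] at h1
  have h2 : z ^ H.index = 1 := by
    have := congr_arg (fun x : H ↦ (x : E)) h1
    simpa using this
  rw [hidx] at h2
  -- orders: z^p = 1 and z^{(p+1)(p-1)} = 1
  have hcop : Nat.Coprime ((p + 1) * (p - 1)) p := by
    rw [Nat.coprime_comm, Nat.Prime.coprime_iff_not_dvd hp]
    intro h
    rcases (Nat.Prime.dvd_mul hp).mp h with h' | h'
    · have h1 : p ∣ 1 := (Nat.dvd_add_right (dvd_refl p)).mp h'
      exact absurd (Nat.le_of_dvd one_pos h1) (by have := hp.one_lt; omega)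
    · have h1 := Nat.eq_zero_of_dvd_of_lt h' (by have := hp.one_lt; omega)
      have := hp.two_le; omega
  have h3 : orderOf z ∣ Nat.gcd ((p + 1) * (p - 1)) p :=
    Nat.dvd_gcd (orderOf_dvd_of_pow_eq_one h2) (orderOf_dvd_of_pow_eq_one (hexp z hz))
  rw [hcop, Nat.dvd_one] at h3
  exact orderOf_eq_one_iff.mp h3


/-- Induction on `e` (modulus form `n = p^e`, so that `e = 1` specialises to `ℤ/p`). [cite: Beyl1986, Theorem
(M(SL(2,ℤ/m)) = 0 for 4 ∤ m), p-primary part] -/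
theorem ker_inf_commutator_eq_bot_aux (p : ℕ) [Fact p.Prime] (hp5 : 5 ≤ p) :
    ∀ (e n : ℕ), n = p ^ e → ∀ (E : Type u) [Group E] (π : E →* SL(2, ZMod n)), Function.Surjective π →
      (∀ z : E, π z = 1 → ∀ g : E, g * z = z * g) → (∀ z : E, π z = 1 → z ^ p = 1) →
      ∀ z : E, π z = 1 → z ∈ commutator E → z = 1 := by
  intro e
  induction e with
  | zero =>
    intro n hn E _ π _ hcen _ z _ hzc
    subst hn
    haveI : Subsingleton (ZMod (p ^ 0)) := by rw [pow_zero]; infer_instance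
    haveI : Subsingleton SL(2, ZMod (p ^ 0)) :=
      ⟨fun a b ↦ Subtype.ext (Subsingleton.elim _ _)⟩
    have hall : ∀ x : E, π x = 1 := fun x ↦ Subsingleton.elim _ _
    have hbot : commutator E = ⊥ := by
      rw [commutator_def, Subgroup.commutator_eq_bot_iff_le_centralizer]
      intro g _
      rw [Subgroup.mem_centralizer_iff]
      intro h _
      exact hcen g (hall g) h
    rw [hbot, Subgroup.mem_bot] at hzc
    exact hzc
  | succ k ih =>
    intro n hn E _ π hsurj hcen hexp
    rcases k with _ | k
    · rw [zero_add, pow_one] at hn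
      subst hn
      exact base _ π hsurj hcen hexp
    · subst hn
      exact step _ hp5 (k + 1 + 1) (by omega) π hsurj hcen hexp
        (fun E' _ π' hs hc he ↦ ih _ rfl E' π' hs hc he)

/-- **Theorem (the `p`-primary part of the Schur multiplier of `SL₂(ℤ/p^e)` vanishes, `p ≥ 5`).** For a prime `p
≥ 5`, every `e ≥ 0` and every surjection `π : E → SL₂(ℤ/p^e)` whose kernel is central of exponent `p`: `ker π ∩
[E, E] = 1`.  Equivalently `Hom(H₂(SL₂(ℤ/p^e), ℤ), 𝔽_p) = 0`; this is the `p`-part of Beyl's `M(SL₂(ℤ/m)) = 0`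
(`4 ∤ m`) and the finite-level content of `H₂(SL₂(ℤ_p), ℤ) = 0` [CalegariDimitrovTang2025, Lemma 4.5.11]; it is
the input at `ℓ = p`, `p² ∣ N` of the invariant form of [CalegariDimitrovTang2025, Cor. 4.5.3].  Proof:
induction on `e` by the elementary descent of `SL2PrimePowCentralExtensionLayer` (no cohomology, no Lazard): the
top layer of the congruence filtration splits off `E`-equivariantly. [cite: Beyl1986, Theorem (M(SL(2,ℤ/m)) = 0
for 4 ∤ m), p-primary part] -/
theorem eq_one_of_mem_ker_of_mem_commutator (p : ℕ) [Fact p.Prime] (hp5 : 5 ≤ p) (e : ℕ) {E : Type u} [Group E]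
    (π : E →* SL(2, ZMod (p ^ e))) (hsurj : Function.Surjective π)
    (hcen : ∀ z : E, π z = 1 → ∀ g : E, g * z = z * g) (hexp : ∀ z : E, π z = 1 → z ^ p = 1)
    {z : E} (hz : π z = 1) (hzc : z ∈ commutator E) : z = 1 :=
  ker_inf_commutator_eq_bot_aux p hp5 e (p ^ e) rfl E π hsurj hcen hexp z hz hzc

end induction

end SL2SchurMultiplier

end Literature.GroupTheory.ArithmeticGroups
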